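import Summits.CriticalPhenomena.PercolationContinuityZ3.Theorems.PercNearOneGluingNoHeavyLowerTailSahiSliceMinimumBernstein
import Summits.CriticalPhenomena.PercolationContinuityZ3.Theorems.SahiMasterFamilyCoordPolyPeel
import Mathlib.Analysis.Calculus.Deriv.Mul
import Mathlib.Analysis.Calculus.Deriv.Add
import Mathlib.Analysis.Calculus.Deriv.Pow

/-!
# `NoHeavyLowerTail` (crux stmt-CriticalPhenomena-4575), Sahi programme P2 (gen 17): THE GRADIENT SLICE PRINCIPLE — the
# self-improved form of the slice minimum principle — and the calculus of the fibre cubic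

Support file (`--supports stmt-CriticalPhenomena-4575`; companion of `…SahiSliceMinimum` (gen 16) and `…SahiSliceMinimumBlowup`
(gen 17)).  Nothing here asserts Kahn's or Sahi's conjecture: the principle below is TYPED (`@[conjecture]`) and the file proves
its calculus and its reductions.

THE FIBRE CUBIC.  Along one coin `e` with bias `s`, `E₃(μ_{p[e↦s]}; f,g,h)` is the tree's cubic `cubicE3 p e f g h s`
(`sahiE_three_update_eq`).  We record its DERIVATIVE in closed form (`hasDerivAt_cubicE3`: with section moments
`m_k(s) = sX₁(k) + (1−s)X₀(k)` (`secM`, the evaluation of the tree's moment map `secPoly`) and influences `Δk = X₁(k) − X₀(k)` (the tree's `secDelta`),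
`Φ′(s) = 2Δ(fgh) + [Δf·m_g·m_h + m_f·Δg·m_h + m_f·m_g·Δh] − [Δf·m_{gh} + m_f·Δ(gh) + Δg·m_{fh} + m_g·Δ(fh) + Δh·m_{fg} + m_h·Δ(fg)]`),
the slope `fibreSlope p e f g h := deriv (cubicE3 p e f g h) (p e)` of `E₃` in the bias of `e` at the actual measure, and the CHORD
IDENTITY `(1−s)Φ(0) + sΦ(1) − Φ(s) = ½ s(1−s)·Φ″(s) + s(1−s)(1−2s)·c₃` with `c₃ = Δf·Δg·Δh` the cubic coefficient (product of the
three influences, `≥ 0` for increasing events) (`cubicE3_chord_sub`).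

THE GRADIENT SLICE PRINCIPLE (`GradientSlicePrinciple`, new; census-clean; see the memo).  For every product measure with a live
coin and every triple of increasing events there is a LIVE coin `e` with
  `E₃(μ_{p[e↦1]}) ≤ E₃(μ_p)`   or   ( `E₃(μ_{p[e↦0]}) ≤ E₃(μ_p)` and `∂E₃/∂p_e ≥ 0` ):
"`E₃` dominates some TOP facet, or some BOTTOM facet along a coin in whose bias `E₃` is non-decreasing."  It implies the slice
minimum principle of order 3 outright (`sliceMinimumPrinciple_three_of_gradientSlice`), hence Kahn's Conjecture 5
(`kahnConjecture_of_gradientSlice`); CONVERSELY (paper, memo FROM-prim-masterthm-p2-g17-BLOWUP.md §1, and the kernel file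
`…SahiSliceMinimumBlowup` for the finite form) the slice minimum principle on ALL cubes implies it, by composing the triple with
OR-blocks of fresh coins — so over all cubes the two principles are EQUIVALENT.  Evidence (seat, exact engines + per-triple
measure-optimising adversary — the search that refuted BMP/UA in minutes): exhaustive `m = 3`, adversarial `m = 3..7` (≈ 10⁶ optimised
triples) for the gradient form and for the stronger monotone-side form, 0 violations; kit censuses `m ≤ 8` (j163552/j163557/j163561)
were running when this file was written — see the seat's STATUS for the fold.
HONEST LABEL: a typed conjecture with kernel-checked calculus and reductions; `C₃` remains OPEN. [this work]
-/

noncomputable section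

open scoped Classical

namespace Summit.CriticalPhenomena.PercolationContinuityZ3.Theorems

open Finset Function
open Literature.Combinatorics.Sahi2008
open Literature.Probability.Percolation.DecisionTree (ind ind_of_mem ind_of_not_mem ind_nonneg)

namespace SahiSliceMinimum

variable {ι : Type*} [Fintype ι]

/-! ### Calculus of the fibre cubic -/

/-- The section moment at bias `s`: `m_k(s) = s·X₁(k) + (1−s)·X₀(k)`. [folklore] -/
def secM (p : ι → unitInterval) (e : ι) (k : Set ι → ℝ) (s : ℝ) : ℝ := s * secEx p e k true + (1 - s) * secEx p e k false

/-- `m_k(s) = X₀(k) + s·Δk`. [folklore] -/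
theorem secM_eq (p : ι → unitInterval) (e : ι) (k : Set ι → ℝ) (s : ℝ) :
    secM p e k s = secEx p e k false + s * secDelta p e k := by
  unfold secM secDelta; ring

/-- `m_k` is affine with slope `Δk`. [folklore] -/
theorem hasDerivAt_secM (p : ι → unitInterval) (e : ι) (k : Set ι → ℝ) (s : ℝ) :
    HasDerivAt (secM p e k) (secDelta p e k) s := by
  have raw := ((hasDerivAt_id s).mul_const (secEx p e k true)).add
    (((hasDerivAt_const s (1 : ℝ)).sub (hasDerivAt_id s)).mul_const (secEx p e k false))
  refine (raw.congr_of_eventuallyEq (Filter.Eventually.of_forall fun y => ?_)).congr_deriv ?_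
  · simp only [secM, Pi.add_apply, Pi.sub_apply, id]
  · simp only [secDelta]; ring

/-- The fibre cubic in terms of `secM`. [folklore] -/
theorem cubicE3_eq_secM (p : ι → unitInterval) (e : ι) (f g h : Set ι → ℝ) (s : ℝ) :
    cubicE3 p e f g h s =
      2 * secM p e (f * g * h) s + secM p e f s * secM p e g s * secM p e h s -
        (secM p e f s * secM p e (g * h) s + secM p e g s * secM p e (f * h) s + secM p e h s * secM p e (f * g) s) := by
  simp only [cubicE3, secM]

/-- The explicit derivative of the fibre cubic at `s` (the "slope formula"). [this work] -/
def cubicE3Deriv (p : ι → unitInterval) (e : ι) (f g h : Set ι → ℝ) (s : ℝ) : ℝ :=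
  2 * secDelta p e (f * g * h) +
      (secDelta p e f * secM p e g s * secM p e h s + secM p e f s * secDelta p e g * secM p e h s +
        secM p e f s * secM p e g s * secDelta p e h) -
    (secDelta p e f * secM p e (g * h) s + secM p e f s * secDelta p e (g * h) +
      (secDelta p e g * secM p e (f * h) s + secM p e g s * secDelta p e (f * h)) +
      (secDelta p e h * secM p e (f * g) s + secM p e h s * secDelta p e (f * g)))

/-- **The derivative of the fibre cubic**: `Φ′(s) = cubicE3Deriv … s`. [this work] -/
theorem hasDerivAt_cubicE3 (p : ι → unitInterval) (e : ι) (f g h : Set ι → ℝ) (s : ℝ) :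
    HasDerivAt (cubicE3 p e f g h) (cubicE3Deriv p e f g h s) s := by
  have hfun : cubicE3 p e f g h = fun x =>
      2 * secM p e (f * g * h) x + secM p e f x * secM p e g x * secM p e h x -
        (secM p e f x * secM p e (g * h) x + secM p e g x * secM p e (f * h) x + secM p e h x * secM p e (f * g) x) := by
    funext x; exact cubicE3_eq_secM p e f g h x
  have dF := hasDerivAt_secM p e f s
  have dG := hasDerivAt_secM p e g s
  have dH := hasDerivAt_secM p e h s
  have dFG := hasDerivAt_secM p e (f * g) s
  have dFH := hasDerivAt_secM p e (f * h) s
  have dGH := hasDerivAt_secM p e (g * h) s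
  have dFGH := hasDerivAt_secM p e (f * g * h) s
  have raw := ((dFGH.const_mul (2 : ℝ)).add ((dF.mul dG).mul dH)).sub (((dF.mul dGH).add (dG.mul dFH)).add (dH.mul dFG))
  refine (raw.congr_of_eventuallyEq (Filter.Eventually.of_forall fun y => ?_)).congr_deriv ?_
  · rw [hfun]
    simp only [Pi.add_apply, Pi.sub_apply, Pi.mul_apply]
  · simp only [cubicE3Deriv, Pi.mul_apply]; ring

/-- `deriv` of the fibre cubic. [this work] -/
theorem deriv_cubicE3 (p : ι → unitInterval) (e : ι) (f g h : Set ι → ℝ) (s : ℝ) :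
    deriv (cubicE3 p e f g h) s = cubicE3Deriv p e f g h s :=
  (hasDerivAt_cubicE3 p e f g h s).deriv

/-- **The slope of `E₃` in the bias of coin `e` at the actual measure**: `∂E₃(μ_p; f,g,h)/∂p_e = Φ′(p_e)`. [this work] -/
def fibreSlope (p : ι → unitInterval) (e : ι) (f g h : Set ι → ℝ) : ℝ := deriv (cubicE3 p e f g h) (p e)

/-- The slope in closed form. [this work] -/
theorem fibreSlope_eq (p : ι → unitInterval) (e : ι) (f g h : Set ι → ℝ) :
    fibreSlope p e f g h = cubicE3Deriv p e f g h (p e) :=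
  deriv_cubicE3 p e f g h (p e)

/-- The explicit SECOND derivative of the fibre cubic at `s`:
`½Φ″(s) = Σ_i m_i·Δj·Δk − Σ_i Δi·Δ(jk)`. [this work] -/
def cubicE3Deriv2 (p : ι → unitInterval) (e : ι) (f g h : Set ι → ℝ) (s : ℝ) : ℝ :=
  2 * ((secM p e f s * secDelta p e g * secDelta p e h + secDelta p e f * secM p e g s * secDelta p e h +
        secDelta p e f * secDelta p e g * secM p e h s) -
      (secDelta p e f * secDelta p e (g * h) + secDelta p e g * secDelta p e (f * h) + secDelta p e h * secDelta p e (f * g)))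

/-- `Φ″(s) = cubicE3Deriv2 … s`. [this work] -/
theorem hasDerivAt_cubicE3Deriv (p : ι → unitInterval) (e : ι) (f g h : Set ι → ℝ) (s : ℝ) :
    HasDerivAt (cubicE3Deriv p e f g h) (cubicE3Deriv2 p e f g h s) s := by
  have dF := hasDerivAt_secM p e f s
  have dG := hasDerivAt_secM p e g s
  have dH := hasDerivAt_secM p e h s
  have dFG := hasDerivAt_secM p e (f * g) s
  have dFH := hasDerivAt_secM p e (f * h) s
  have dGH := hasDerivAt_secM p e (g * h) s
  have h1 := (hasDerivAt_const s (2 * secDelta p e (f * g * h))).add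
    ((((dG.const_mul (secDelta p e f)).mul dH).add (((dF.mul_const (secDelta p e g))).mul dH)).add
      ((dF.mul dG).mul_const (secDelta p e h)))
  have h2 := ((dGH.const_mul (secDelta p e f)).add (dF.mul_const (secDelta p e (g * h)))).add
    (((dFH.const_mul (secDelta p e g)).add (dG.mul_const (secDelta p e (f * h)))).add
      ((dFG.const_mul (secDelta p e h)).add (dH.mul_const (secDelta p e (f * g)))))
  have raw := h1.sub h2
  refine (raw.congr_of_eventuallyEq (Filter.Eventually.of_forall fun y => ?_)).congr_deriv ?_
  · simp only [cubicE3Deriv, Pi.add_apply, Pi.sub_apply, Pi.mul_apply]; ring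
  · simp only [cubicE3Deriv2]; ring

/-- **The chord identity of the fibre cubic**: the chord through the two facet values exceeds the fibre by
`½ s(1−s)·Φ″(s) + s(1−s)(1−2s)·c₃`, `c₃ = Δf·Δg·Δh` the cubic coefficient (`cubicE3_third_difference`). [this work] -/
theorem cubicE3_chord_sub (p : ι → unitInterval) (e : ι) (f g h : Set ι → ℝ) (s : ℝ) :
    (1 - s) * cubicE3 p e f g h 0 + s * cubicE3 p e f g h 1 - cubicE3 p e f g h s =
      s * (1 - s) / 2 * cubicE3Deriv2 p e f g h s + s * (1 - s) * (1 - 2 * s) * (secDelta p e f * secDelta p e g * secDelta p e h) := by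
  simp only [cubicE3_eq_secM, cubicE3Deriv2, secM, secDelta]
  ring

/-- Taylor identity at the bottom facet: `Φ(0) = Φ(s) − sΦ′(s) + ½s²Φ″(s) − s³c₃`. [this work] -/
theorem cubicE3_zero_taylor (p : ι → unitInterval) (e : ι) (f g h : Set ι → ℝ) (s : ℝ) :
    cubicE3 p e f g h 0 = cubicE3 p e f g h s - s * cubicE3Deriv p e f g h s + s ^ 2 / 2 * cubicE3Deriv2 p e f g h s -
      s ^ 3 * (secDelta p e f * secDelta p e g * secDelta p e h) := by
  simp only [cubicE3_eq_secM, cubicE3Deriv, cubicE3Deriv2, secM, secDelta]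
  ring

/-- Taylor identity at the top facet: `Φ(1) = Φ(s) + (1−s)Φ′(s) + ½(1−s)²Φ″(s) + (1−s)³c₃`. [this work] -/
theorem cubicE3_one_taylor (p : ι → unitInterval) (e : ι) (f g h : Set ι → ℝ) (s : ℝ) :
    cubicE3 p e f g h 1 = cubicE3 p e f g h s + (1 - s) * cubicE3Deriv p e f g h s +
      (1 - s) ^ 2 / 2 * cubicE3Deriv2 p e f g h s + (1 - s) ^ 3 * (secDelta p e f * secDelta p e g * secDelta p e h) := by
  simp only [cubicE3_eq_secM, cubicE3Deriv, cubicE3Deriv2, secM, secDelta]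
  ring

/-- `Φ″` is affine with slope `6c₃`: `Φ″(s) = (1−s)Φ″(0) + sΦ″(1)`. [this work] -/
theorem cubicE3Deriv2_affine (p : ι → unitInterval) (e : ι) (f g h : Set ι → ℝ) (s : ℝ) :
    cubicE3Deriv2 p e f g h s = (1 - s) * cubicE3Deriv2 p e f g h 0 + s * cubicE3Deriv2 p e f g h 1 := by
  simp only [cubicE3Deriv2, secM]
  ring

/-- `Φ″(1) − Φ″(0) = 6c₃`. [this work] -/
theorem cubicE3Deriv2_one_sub_zero (p : ι → unitInterval) (e : ι) (f g h : Set ι → ℝ) :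
    cubicE3Deriv2 p e f g h 1 - cubicE3Deriv2 p e f g h 0 = 6 * (secDelta p e f * secDelta p e g * secDelta p e h) := by
  simp only [cubicE3Deriv2, secM, secDelta]
  ring

/-- **A CONCAVE fibre is gradient-slice-good at its own coin**: if `Φ″(0) ≤ 0`, `Φ″(1) ≤ 0` (so `Φ` is concave on `[0,1]`) and the
cubic coefficient `c₃ = Δf·Δg·Δh` is `≥ 0` (automatic for increasing events), then for `s ∈ [0,1]`:
`Φ′(s) ≥ 0 ⟹ Φ(0) ≤ Φ(s)` and `Φ′(s) ≤ 0 ⟹ Φ(1) ≤ Φ(s)` (the fibre lies below its tangent). [this work] -/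
theorem facet_le_of_concave (p : ι → unitInterval) (e : ι) (f g h : Set ι → ℝ) {s : ℝ} (hs0 : 0 ≤ s) (hs1 : s ≤ 1)
    (hc3 : 0 ≤ secDelta p e f * secDelta p e g * secDelta p e h) (h0 : cubicE3Deriv2 p e f g h 0 ≤ 0)
    (h1 : cubicE3Deriv2 p e f g h 1 ≤ 0) :
    (0 ≤ cubicE3Deriv p e f g h s → cubicE3 p e f g h 0 ≤ cubicE3 p e f g h s) ∧
      (cubicE3Deriv p e f g h s ≤ 0 → cubicE3 p e f g h 1 ≤ cubicE3 p e f g h s) := by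
  have hT0 := cubicE3_zero_taylor p e f g h s
  have hT1 := cubicE3_one_taylor p e f g h s
  have hA := cubicE3Deriv2_affine p e f g h s
  have hD2s : cubicE3Deriv2 p e f g h s ≤ 0 := by
    rw [hA]; nlinarith
  constructor
  · intro hd
    have h2 : s ^ 2 / 2 * cubicE3Deriv2 p e f g h s ≤ 0 :=
      mul_nonpos_of_nonneg_of_nonpos (by positivity) hD2s
    have h3 : 0 ≤ s ^ 3 * (secDelta p e f * secDelta p e g * secDelta p e h) := mul_nonneg (pow_nonneg hs0 3) hc3
    nlinarith
  · intro hd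
    -- `½(1−s)²Φ″(s) + (1−s)³c₃ = (1−s)²·[(1−s)/3·Φ″(0) + (1+2s)/6·Φ″(1)] ≤ 0`
    have hsub := cubicE3Deriv2_one_sub_zero p e f g h
    have h1s : 0 ≤ 1 - s := sub_nonneg.2 hs1
    have key : (1 - s) ^ 2 / 2 * cubicE3Deriv2 p e f g h s + (1 - s) ^ 3 * (secDelta p e f * secDelta p e g * secDelta p e h) =
        (1 - s) ^ 2 * ((1 - s) / 3 * cubicE3Deriv2 p e f g h 0 + (1 + 2 * s) / 6 * cubicE3Deriv2 p e f g h 1) := by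
      rw [hA]; linear_combination (-(1 - s) ^ 3 / 6) * hsub
    have hin : (1 - s) / 3 * cubicE3Deriv2 p e f g h 0 + (1 + 2 * s) / 6 * cubicE3Deriv2 p e f g h 1 ≤ 0 := by
      have a1 : (1 - s) / 3 * cubicE3Deriv2 p e f g h 0 ≤ 0 :=
        mul_nonpos_of_nonneg_of_nonpos (by linarith) h0
      have a2 : (1 + 2 * s) / 6 * cubicE3Deriv2 p e f g h 1 ≤ 0 :=
        mul_nonpos_of_nonneg_of_nonpos (by linarith) h1
      linarith
    have hneg : (1 - s) ^ 2 * ((1 - s) / 3 * cubicE3Deriv2 p e f g h 0 + (1 + 2 * s) / 6 * cubicE3Deriv2 p e f g h 1) ≤ 0 :=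
      mul_nonpos_of_nonneg_of_nonpos (sq_nonneg _) hin
    have hd' : (1 - s) * cubicE3Deriv p e f g h s ≤ 0 := mul_nonpos_of_nonneg_of_nonpos h1s hd
    linarith [hT1, key, hneg, hd']

/-! ### The gradient slice principle (typed) and its reductions -/

/-- **THE GRADIENT SLICE PRINCIPLE** (this seat, gen 17; the self-improved form of `SliceMinimumPrinciple 3`): for every finite `ι`,
every `p : ι → [0,1]` with a live coin and every three increasing events `U_j ⊆ 2^ι`, some LIVE coin `e` has
`E₃(μ_{p[e↦1]}; 1_U) ≤ E₃(μ_p; 1_U)`, or `E₃(μ_{p[e↦0]}; 1_U) ≤ E₃(μ_p; 1_U)` together with `∂E₃/∂p_e ≥ 0` (`fibreSlope`).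
Equivalent over all cubes to the slice minimum principle (it implies it here; the converse is the OR-blow-up of
`…SahiSliceMinimumBlowup` plus a limit, on paper).  An obligation / hypothesis; never import it as a fact.
[this work] [status: open; conjecture] -/
@[conjecture] def GradientSlicePrinciple : Prop :=
  ∀ (ι : Type) [Fintype ι] (p : ι → unitInterval) (U : Fin 3 → Set (Set ι)),
    (∀ j, IsUpperSet (U j)) → (liveSet p).Nonempty →
      ∃ e ∈ liveSet p,
        sahiE (bernoulliWeight (Function.update p e 1)) 3 (fun j => ind (U j)) ≤
            sahiE (bernoulliWeight p) 3 (fun j => ind (U j)) ∨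
          (sahiE (bernoulliWeight (Function.update p e 0)) 3 (fun j => ind (U j)) ≤
              sahiE (bernoulliWeight p) 3 (fun j => ind (U j)) ∧
            0 ≤ fibreSlope p e (ind (U 0)) (ind (U 1)) (ind (U 2)))

/-- **The gradient slice principle implies the slice minimum principle of order 3** (drop the slope information). [this work] -/
theorem sliceMinimumPrinciple_three_of_gradientSlice (h : GradientSlicePrinciple) : SliceMinimumPrinciple 3 := by
  intro ι _ p U hU hlive
  obtain ⟨e, he, hcase⟩ := h ι p U hU hlive
  rcases hcase with htop | ⟨hbot, -⟩
  · exact ⟨e, he, 1, Or.inr Set.Icc.coe_one, htop⟩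
  · exact ⟨e, he, 0, Or.inl Set.Icc.coe_zero, hbot⟩

/-- **Hence the gradient slice principle implies Kahn's Conjecture 5** (and Sahi's `C₃`). [this work] -/
theorem kahnConjecture_of_gradientSlice (h : GradientSlicePrinciple) : KahnConjecture :=
  kahnConjecture_of_sliceMinimumPrinciple (sliceMinimumPrinciple_three_of_gradientSlice h)

/-- And Sahi's `C₃` for every FKG measure on every finite distributive lattice. [this work] -/
theorem sahiConjecture_three_of_gradientSlice (h : GradientSlicePrinciple) : SahiConjecture 3 :=
  sahiConjecture_three_of_sliceMinimumPrinciple (sliceMinimumPrinciple_three_of_gradientSlice h)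

/-! ### A proved family: diagonal triples are gradient-slice-good at EVERY coin -/

/-- The second derivative of the diagonal fibre: `Φ″(s) = 6Δ²(m(s) − 1)` with `Δ = X₁(1_U) − X₀(1_U)`. [this work] -/
theorem cubicE3Deriv2_diag (p : ι → unitInterval) (e : ι) (U : Set (Set ι)) (s : ℝ) :
    cubicE3Deriv2 p e (ind U) (ind U) (ind U) s = 6 * secDelta p e (ind U) ^ 2 * (secM p e (ind U) s - 1) := by
  have h2 : ind U * ind U = ind U := ind_mul_self U
  simp only [cubicE3Deriv2, h2, secDelta, secM]
  ring

/-- **Diagonal triples `(U,U,U)` satisfy the gradient slice alternative at EVERY coin** (the fibre `φ(m(s))`,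
`φ(x) = x(1−x)(2−x)`, is concave): `E₃(μ_{p[e↦1]}) ≤ E₃(μ_p)`, or `E₃(μ_{p[e↦0]}) ≤ E₃(μ_p)` with `∂E₃/∂p_e ≥ 0`. [this work] -/
theorem gradientSlice_diag (p : ι → unitInterval) {U : Set (Set ι)} (hU : IsUpperSet U) (e : ι) :
    sahiE (bernoulliWeight (update p e 1)) 3 ![ind U, ind U, ind U] ≤ sahiE (bernoulliWeight p) 3 ![ind U, ind U, ind U] ∨
      (sahiE (bernoulliWeight (update p e 0)) 3 ![ind U, ind U, ind U] ≤ sahiE (bernoulliWeight p) 3 ![ind U, ind U, ind U] ∧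
        0 ≤ fibreSlope p e (ind U) (ind U) (ind U)) := by
  set s : unitInterval := p e with hs
  have hp : p = update p e s := by rw [hs, update_eq_self]
  have hG : sahiE (bernoulliWeight p) 3 ![ind U, ind U, ind U] = cubicE3 p e (ind U) (ind U) (ind U) s := by
    conv_lhs => rw [hp]
    exact sahiE_three_update_eq p e s (ind U) (ind U) (ind U)
  have h1 : sahiE (bernoulliWeight (update p e 1)) 3 ![ind U, ind U, ind U] = cubicE3 p e (ind U) (ind U) (ind U) 1 := by
    rw [sahiE_three_update_eq]; simp
  have h0 : sahiE (bernoulliWeight (update p e 0)) 3 ![ind U, ind U, ind U] = cubicE3 p e (ind U) (ind U) (ind U) 0 := by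
    rw [sahiE_three_update_eq]; simp
  -- concavity data
  have hΔ : 0 ≤ secDelta p e (ind U) := sub_nonneg.2 (secEx_ind_mono p e hU)
  have hc3 : 0 ≤ secDelta p e (ind U) * secDelta p e (ind U) * secDelta p e (ind U) := mul_nonneg (mul_nonneg hΔ hΔ) hΔ
  have hm1 : secM p e (ind U) 1 ≤ 1 := by
    simp only [secM, one_mul, sub_self, zero_mul, add_zero]; exact (secEx_ind_mem p e U true).2
  have hm0 : secM p e (ind U) 0 ≤ 1 := by
    simp only [secM, zero_mul, sub_zero, one_mul, zero_add]; exact (secEx_ind_mem p e U false).2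
  have hD0 : cubicE3Deriv2 p e (ind U) (ind U) (ind U) 0 ≤ 0 := by
    rw [cubicE3Deriv2_diag]
    exact mul_nonpos_of_nonneg_of_nonpos (by positivity) (by linarith)
  have hD1 : cubicE3Deriv2 p e (ind U) (ind U) (ind U) 1 ≤ 0 := by
    rw [cubicE3Deriv2_diag]
    exact mul_nonpos_of_nonneg_of_nonpos (by positivity) (by linarith)
  obtain ⟨hbot, htop⟩ := facet_le_of_concave p e (ind U) (ind U) (ind U) s.2.1 s.2.2 hc3 hD0 hD1
  rw [hG, h1, h0, fibreSlope_eq, ← hs]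
  rcases le_total 0 (cubicE3Deriv p e (ind U) (ind U) (ind U) s) with hd | hd
  · exact Or.inr ⟨hbot hd, hd⟩
  · exact Or.inl (htop hd)

end SahiSliceMinimum

end Summit.CriticalPhenomena.PercolationContinuityZ3.Theorems
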